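import Literature.NumberTheory.Automorphic.SymplecticSimilitudeIwasawaCartan
import Literature.NumberTheory.Automorphic.SymplecticSimilitudeSatakeTransform
import HarnessLib

/-!
# Functoriality of the abstract Satake transform in the exponent lattice (`Λ → Λ'`); the multiplier-degree transform of
# `GSp_{2n}`

Topic `NumberTheory/Automorphic`; namespaces `Literature.NumberTheory.Automorphic.IsIwasawaExponent` (§1, abstract) and
`Literature.NumberTheory.Automorphic.SymplecticCartan` (§2, `GSp_{2n}`) (lane `lit-hodgefound`, Track 2 foundations; seat
`lit-hodgefound-p11`, generation 37, row g37-#20).  THEOREMS ONLY: no definition, no named fact, no instance, no notation.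
Sequel of `SatakeTransformIwasawa` (`IsIwasawaExponent.comp`: pushing an Iwasawa datum forward along `f : Λ →+ Λ'`).

## The print

[CartierCorvallis1979] §IV (4.2)–(4.3): the Satake transform is natural in the torus — restricting `Sf` along a quotient
`Λ → Λ'` of the cocharacter lattice (e.g. to the centre / the similitude character) is the transform for the pushed-forward
datum; [AndrianovZhuravlev1995] Ch. 3 §3.3 (the variable `x₀` of `Ω` records the multiplier: specialising `x₁ = ⋯ = x_n = 1`
leaves the degree times `x₀^{ord r}`).  Here: for `h : IsIwasawaExponent P K a` and `f : Λ →+ Λ'`,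
**`(h.comp f).satakeTransform w' = mapDomain f ∘ h.satakeTransform (w' ∘ f)`**, and the eigencharacters pull back
accordingly; for `GSp_{2n}` and `f = snd` (the multiplier exponent `c`), the transform of `T_g` is `deg(T_g) · x^{c(g)}`
(the multiplier valuation is constant on double cosets).

## What is formalised

* §1 `satakeVec_comp_apply`, **`satakeTransform_comp`**, (private `lift_comp_mapDomainAlgHom`), **`heckeEigencharacter_comp`**
  (`(h.comp f).heckeEigencharacter w' χ' = h.heckeEigencharacter (w' ∘ f) (χ' ∘ f)`).
* §2 (`GSp_{2n}`, `n ≠ 0`) `snd_similitudeIwasawaExp_eq_of_mem_orbit_coe` (`c` is constant on `K₀ g K₀`),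
  **`satakeTransform_multiplier_doubleCosetOperator`** (the transform of the datum `c = snd ∘ (a, c)` with trivial weight
  sends `T_g` to `#(K₀gK₀/K₀) · x^{c(g)}`), `satakeTransform_multiplier_eq_mapDomain` (it is `mapDomain snd` of the
  counting transform of `GSp_{2n}`).

## References
* [CartierCorvallis1979] P. Cartier, *Representations of 𝔭-adic groups: a survey*, PSPM 33.1 (1979), §IV (4.2)–(4.3).
* [AndrianovZhuravlev1995] A. N. Andrianov, V. G. Zhuravlev, *Modular Forms and Hecke Operators* (1995), Ch. 3 §3.3.
-/

noncomputable section

open scoped Valued WithZero MatrixGroups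
open MulAction MonoidAlgebra Representation Finset

namespace Literature.NumberTheory.Automorphic

variable {G : Type*} [Group G] {Λ Λ' : Type*} [AddCommGroup Λ] [AddCommGroup Λ'] {R : Type*} [CommRing R]

namespace IsIwasawaExponent

/-! ## §1 Pushing the exponent lattice forward -/

/-- **`satakeVec` is natural in `Λ`**: for `f : Λ →+ Λ'`, the transform of the exponent map `f ∘ a` with weight `w'` is
`mapDomain f` of the transform of `a` with weight `w' ∘ f`. [cite: CartierCorvallis1979, §IV (4.2)–(4.3)] -/
theorem satakeVec_comp_apply (K : Subgroup G) (a : G → Λ) (f : Λ →+ Λ') (w' : Multiplicative Λ' →* R)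
    (x : MonoidAlgebra R (G ⧸ K)) :
    satakeVec K (f ∘ a) w' x =
      AddMonoidAlgebra.mapDomainAlgHom R R f (satakeVec K a (w'.comp (AddMonoidHom.toMultiplicative f)) x) := by
  rw [satakeVec_apply, satakeVec_apply, map_sum]
  refine Finset.sum_congr rfl fun γ _ => ?_
  rw [map_smul, AddMonoidAlgebra.mapDomainAlgHom_apply, AddMonoidAlgebra.mapDomain_single]
  rfl

variable {P K : Subgroup G} {a : G → Λ}

/-- **THE SATAKE TRANSFORM IS NATURAL IN THE EXPONENT LATTICE**:
`(h.comp f).satakeTransform w' = mapDomain f ∘ h.satakeTransform (w' ∘ f)`. [cite: CartierCorvallis1979, §IV (4.2)–(4.3)] -/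
theorem satakeTransform_comp (h : IsIwasawaExponent P K a) (f : Λ →+ Λ') (w' : Multiplicative Λ' →* R) :
    (h.comp f).satakeTransform w' =
      (AddMonoidAlgebra.mapDomainAlgHom R R f).comp (h.satakeTransform (w'.comp (AddMonoidHom.toMultiplicative f))) := by
  refine AlgHom.ext fun T => ?_
  rw [satakeTransform_apply, AlgHom.comp_apply, satakeTransform_apply, satakeVec_comp_apply]

omit [Group G] in
/-- Evaluation at `χ'` after `mapDomain f` is evaluation at `χ' ∘ f` (the same statement as
`Literature.AlgebraicGeometry.Motives.Tannakian.lift_comp_mapDomainAlgHom`, restated privately here to keep the automorphic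
import closure free of the Tannakian files). [cite: CartierCorvallis1979, §IV (4.3)] -/
private theorem lift_comp_mapDomainAlgHom (f : Λ →+ Λ') (χ' : Multiplicative Λ' →* R) :
    (AddMonoidAlgebra.lift R R Λ' χ').comp (AddMonoidAlgebra.mapDomainAlgHom R R f) =
      AddMonoidAlgebra.lift R R Λ (χ'.comp (AddMonoidHom.toMultiplicative f)) := by
  refine (AddMonoidAlgebra.lift R R Λ).symm.injective (MonoidHom.ext fun x => ?_)
  rw [AddMonoidAlgebra.lift_symm_apply, AddMonoidAlgebra.lift_symm_apply, AlgHom.comp_apply,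
    AddMonoidAlgebra.mapDomainAlgHom_apply, AddMonoidAlgebra.mapDomain_single, AddMonoidAlgebra.lift_single,
    AddMonoidAlgebra.lift_single]
  rfl

/-- **The eigencharacters pull back**: `λ^{h.comp f}_{w', χ'} = λ^{h}_{w' ∘ f, χ' ∘ f}`. [cite: CartierCorvallis1979, §IV (4.2)–(4.4)] -/
theorem heckeEigencharacter_comp (h : IsIwasawaExponent P K a) (f : Λ →+ Λ') (w' χ' : Multiplicative Λ' →* R) :
    (h.comp f).heckeEigencharacter w' χ' =
      h.heckeEigencharacter (w'.comp (AddMonoidHom.toMultiplicative f)) (χ'.comp (AddMonoidHom.toMultiplicative f)) := by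
  rw [heckeEigencharacter, heckeEigencharacter, satakeTransform_comp, ← AlgHom.comp_assoc, lift_comp_mapDomainAlgHom]

end IsIwasawaExponent

/-! ## §2 The multiplier-degree transform of `GSp_{2n}` -/

namespace SymplecticCartan

open Literature.NumberTheory.Automorphic.CartanUnique

variable {K : Type*} [Field K] [Valued K ℤᵐ⁰] {ϖ : K} {n : ℕ} [NeZero n]

/-- **The multiplier exponent `c` is constant on a double coset**: `c(γ) = c(g)` for every `γ ⊆ K₀ g K₀` (the multiplier of
`GSp(J, 𝒪)` is a unit). [cite: AndrianovZhuravlev1995, Ch. 3 §3 (3.3)] -/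
theorem snd_similitudeIwasawaExp_eq_of_mem_orbit_coe (hϖ : Valued.v ϖ = WithZero.exp (-1 : ℤ))
    (g : symplecticSimilitudeGroup (Fin n) K) {γ : symplecticSimilitudeGroup (Fin n) K ⧸ symplecticSimilitudeInt (Fin n) K}
    (hγ : γ ∈ orbit (symplecticSimilitudeInt (Fin n) K)
      (g : symplecticSimilitudeGroup (Fin n) K ⧸ symplecticSimilitudeInt (Fin n) K)) :
    (similitudeIwasawaExp hϖ γ.out).2 = (similitudeIwasawaExp hϖ g).2 := by
  haveI : Nonempty (Fin n) := ⟨⟨0, Nat.pos_of_ne_zero (NeZero.ne n)⟩⟩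
  have hγ' : (γ.out : symplecticSimilitudeGroup (Fin n) K ⧸ symplecticSimilitudeInt (Fin n) K) ∈
      orbit (symplecticSimilitudeInt (Fin n) K) (g : symplecticSimilitudeGroup (Fin n) K ⧸ symplecticSimilitudeInt (Fin n) K) := by
    rwa [QuotientGroup.out_eq']
  obtain ⟨A, hA, B, hB, h⟩ := (heckeAlgebra.coe_mem_orbit_coe_iff (symplecticSimilitudeInt (Fin n) K) _ _).1 hγ'
  rw [snd_similitudeIwasawaExp, snd_similitudeIwasawaExp, h, multiplier_mul, multiplier_mul, Units.val_mul, Units.val_mul,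
    map_mul, map_mul, v_multiplier_eq_one_of_mem_symplecticSimilitudeInt hA, v_multiplier_eq_one_of_mem_symplecticSimilitudeInt hB,
    one_mul, mul_one]

variable [IsHeckeTriple (⊤ : Submonoid (symplecticSimilitudeGroup (Fin n) K)) (symplecticSimilitudeInt (Fin n) K)
  (symplecticSimilitudeInt (Fin n) K)] {R : Type*} [CommRing R]

/-- **The multiplier-degree transform**: for the pushed-forward datum `c = snd ∘ (a, c)` (exponent lattice `ℤ`, trivial
weight), `𝒮(T_g) = #(K₀gK₀/K₀) · x^{c(g)}` — the degree of `T_g` times the monomial of its multiplier exponent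
(A–Z's `Ω` at `x₁ = ⋯ = x_n = 1` up to normalisation). [cite: AndrianovZhuravlev1995, Ch. 3 §3.3] [cite: CartierCorvallis1979, §IV (4.3)] -/
theorem satakeTransform_multiplier_doubleCosetOperator (hϖ : Valued.v ϖ = WithZero.exp (-1 : ℤ))
    (g : symplecticSimilitudeGroup (Fin n) K) :
    ((isIwasawaExponent_similitude hϖ).comp (AddMonoidHom.snd (Fin n → ℤ) ℤ)).satakeTransform (1 : Multiplicative ℤ →* R)
        (heckeAlgebra.doubleCosetOperator (symplecticSimilitudeInt (Fin n) K) g) =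
      ((finite_orbit_quotient (symplecticSimilitudeInt (Fin n) K) g).toFinset.card : R) •
        AddMonoidAlgebra.single ((similitudeIwasawaExp hϖ g).2) (1 : R) := by
  rw [IsIwasawaExponent.satakeTransform_doubleCosetOperator]
  rw [Finset.sum_congr rfl fun α hα => by
    rw [MonoidHom.one_apply, Function.comp_apply, AddMonoidHom.coe_snd,
      snd_similitudeIwasawaExp_eq_of_mem_orbit_coe hϖ g ((Set.Finite.mem_toFinset _).1 hα)]]
  rw [Finset.sum_const, ← Nat.cast_smul_eq_nsmul R]

omit [IsHeckeTriple (⊤ : Submonoid (symplecticSimilitudeGroup (Fin n) K)) (symplecticSimilitudeInt (Fin n) K)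
  (symplecticSimilitudeInt (Fin n) K)] in
/-- The multiplier-degree transform is `mapDomain snd` of the counting transform (`q = 1`) of `GSp_{2n}`.
[cite: CartierCorvallis1979, §IV (4.3)] -/
theorem satakeTransform_multiplier_eq_mapDomain (hϖ : Valued.v ϖ = WithZero.exp (-1 : ℤ)) :
    ((isIwasawaExponent_similitude hϖ).comp (AddMonoidHom.snd (Fin n → ℤ) ℤ)).satakeTransform (1 : Multiplicative ℤ →* R) =
      (AddMonoidAlgebra.mapDomainAlgHom R R (AddMonoidHom.snd (Fin n → ℤ) ℤ)).comp
        ((isIwasawaExponent_similitude hϖ).satakeTransform 1) := by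
  rw [(isIwasawaExponent_similitude hϖ).satakeTransform_comp, MonoidHom.one_comp]

end SymplecticCartan

end Literature.NumberTheory.Automorphic

end
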